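import Summits.QuantumFields.YangMills.Theorems.FluctuationComparisonRegPrIntLS2BetaBlockPairReadCover
import HarnessLib

/-!
# S2β · THE SUP CHAIN — THICK-READ COVER ((k2‴)): `Σ_B ‖𝟙[READ′^{θr}_t(B)]·g‖² ≤ (2·d·(2k+1)^d)·Σ_B ‖𝟙[READ′_t(B)]·g‖²` for every bond function `g` at level `J+t+1`
# and every thickness `θr ≤ k·L` — the `C_cov` of G4-ii (RULING «SRC-VOL» (R-a)): read-cell sups of thickness `2L+1` are `S′`-shares with `C_cov = 2·d·7^d`

Cell `ym3-torus` (YM ladder rung R3 = continuum `SU(2)` Yang–Mills on the three-torus at fixed lattice data — a RUNG: NOT d = 4, NOT infinite volume,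
NOT a mass gap, NOT Clay).  Width seat «width 21» `ym3-torus-px21` (gen 25), FREE px helper on crux `stmt-QuantumFields-20520`
(`…Theses.UnitScaleTilt.FluctuationComparisonRegPrIntL`), LINE g18-1 S2β.  Architect-lineage px17 g23 2026-08-31 23:30:47Z RULING «SRC-VOL» (R-a) named px21 first refusal
for «the read-cell(2L+1)-vs-READ′ cover, ONE lemma of the ✓p836161∕✓p837136 class»; this is that lemma (the THICKNESS edition of ✓p836161's double count).
`--kind proof --supports stmt-QuantumFields-20520 --as helper`, count-neutral, DEFINITION-FREE (0 `def`, 0 `instance`, 0 `notation`, 0 `sorry`, default heartbeats).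

WHAT IS PROVED (sorry-free).  ★★★`sum_sq_thickReadSup_le_readSup (J t θr k) (hk : θr ≤ k * F.L) (g)`; the thick predicate = the stations' READ′ text with `≤ 2 ↦ ≤ θr`, the thin
one = `E′lam`'s VERBATIM; tools ✓p836161 `card_bonds_nearBox_le`, ✓`natAbs_rel_blockOf_le_of_le_mul`, ✓`natAbs_rel_blockIter_mono`, ✓`natAbs_rel_siteShift`, `bondShift_src∕tgt`.

HONEST SCOPE.  Finite torus bookkeeping; nothing of Bałaban's renormalisation-group analysis is asserted or proved ([Balaban1987RG1] (0.1)–(0.4) pp.251–253;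
[Balaban1985Averaging] Prop. 4 (128)–(135) pp.37–38); G4-ii, (SRC-P)∕(SRC-LIN), `hArc`, (ST⁗)∕LOC⁗, GAP♯∘ (`stub_uniformFibreGapOrbit`, registry 3732b7df UNTOUCHED), the five
registered stubs (0∕5), S2β, 20520, 19936, 19200, `YM3TorusSU2` are NOT proved; no registered stub is closed; rung R3 — NOT d = 4, NOT infinite volume, NOT a mass gap,
NOT Clay; the Yang–Mills mass gap is NOT proved.
-/

set_option autoImplicit false

namespace Summit.QuantumFields.YangMills.Theorems.FluctuationComparisonRegPrIntLS2BetaThickReadCover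

open Finset
open Literature.MathematicalPhysics.QuantumFieldTheory.Balaban1983to89
open T4Continuum T3ContinuumYM3Torus T3TiltDescent T3LevelShift BlockAveraging
open B10Eq27TorusAxialLog (rel rel_apply rel_self)
open Summit.QuantumFields.YangMills.Theorems.FluctuationComparisonRegPrIntLS2BetaReadNesting (natAbs_rel_le_add natAbs_rel_comm)
open Summit.QuantumFields.YangMills.Theorems.FluctuationComparisonRegPrIntLS2BetaTorusCellClasses (natAbs_rel_blockOf_le_of_le_mul natAbs_rel_blockIter_mono)
open Summit.QuantumFields.YangMills.Theorems.FluctuationComparisonRegPrIntLS2BetaLiftLadderCombRowTower (natAbs_rel_siteShift)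
open Summit.QuantumFields.YangMills.Theorems.FluctuationComparisonRegPrIntLS2BetaBlockPairReadCover (card_bonds_nearBox_le)

section Cover

variable {F : T3Family}

/-- ★★★ **THICK-READ COVER** ((k2‴), architect-lineage px17 g23 2026-08-31 23:30:47Z RULING «SRC-VOL» (R-a): the `C_cov` of G4-ii): for ANY bond function `g` at level `J+t+1`
and any thickness `θr ≤ k·L`, `Σ_B ‖𝟙[READ′^{θr}_t(B)]·g‖² ≤ (2·d·(2k+1)^d)·Σ_B ‖𝟙[READ′_t(B)]·g‖²`, where `READ′^{θr}_t(B)` is the stations' READ′ text with the thickness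
`2` replaced by `θr` (the c₁ read cell of ✓p835692∕✓p836340 at `θr = 2L+1`, read back at level `J+t+1` by px13's ✓`read'_transport_of_rel_le`) and the right side is the
thickness-2 READ′ (= `E′lam`'s predicate VERBATIM).  At `θr := 2L+1 ≤ 3L`: `k = 3`, **`C_cov = 2·d·7^d`** (= 2058 at d = 3) — the same count as ✓p836161 (k2).  Mechanism:
`ℓ′` is read at thickness `0` by the top bond `B′ := ⟨σ⁻¹(blockIter (t+1) ℓ′.src), 0⟩`; `|rel z ℓ′.src|_ν ≤ k·L ⟹ |rel (blockOf z) (blockOf ℓ′.src)|_ν ≤ k`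
(✓`natAbs_rel_blockOf_le_of_le_mul`) `⟹ ≤ k` at generation `t+1` (✓`natAbs_rel_blockIter_mono`), so `B′` is within `k` of an endpoint of `B`; ✓`card_bonds_nearBox_le`.
So a chord-class coefficient times a READ-CELL sup² is a WINDOW-SMALL `S′`-share (RULING «SRC-VOL»: quadratic remainders ride in sup currency). [cite: Balaban1987RG1, (0.1)-(0.4) p.251-253; Balaban1985Averaging, Prop. 4 (128)-(135) p.37-38] -/
theorem sum_sq_thickReadSup_le_readSup {E : Type*} [SeminormedAddCommGroup E] (J t θr k : ℕ) (hk : θr ≤ k * F.L)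
    (g : PBond (F.P (J + (t + 1))) 0 → E) :
    ∑ B : PBond (F.P J) 0, ‖(fun ℓ' : PBond (F.P (J + (t + 1))) 0 =>
        if ∃ z : Site (F.P (J + (t + 1))) 0,
                (B14.Eq22Determines.blockIter (t + 1) z = (bondShift (F.sitesPerDir_eq (m := F.m) (K := J) (j := 0) (m' := F.m) (K' := J + (t + 1)) (j' := t + 1) (by omega)) B).src ∨ B14.Eq22Determines.blockIter (t + 1) z = (bondShift (F.sitesPerDir_eq (m := F.m) (K := J) (j := 0) (m' := F.m) (K' := J + (t + 1)) (j' := t + 1) (by omega)) B).tgt) ∧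
                ∀ ν, (B10Eq27TorusAxialLog.rel z ℓ'.src ν).natAbs ≤ θr
        then g ℓ' else 0)‖ ^ 2 ≤
      ((2 * (F.P J).d * (2 * k + 1) ^ (F.P J).d : ℕ) : ℝ) * ∑ B : PBond (F.P J) 0, ‖(fun ℓ' : PBond (F.P (J + (t + 1))) 0 =>
        if ∃ z : Site (F.P (J + (t + 1))) 0,
                (B14.Eq22Determines.blockIter (t + 1) z = (bondShift (F.sitesPerDir_eq (m := F.m) (K := J) (j := 0) (m' := F.m) (K' := J + (t + 1)) (j' := t + 1) (by omega)) B).src ∨ B14.Eq22Determines.blockIter (t + 1) z = (bondShift (F.sitesPerDir_eq (m := F.m) (K := J) (j := 0) (m' := F.m) (K' := J + (t + 1)) (j' := t + 1) (by omega)) B).tgt) ∧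
                ∀ ν, (B10Eq27TorusAxialLog.rel z ℓ'.src ν).natAbs ≤ 2
        then g ℓ' else 0)‖ ^ 2 := by
  classical
  have P₁ : (F.P J).sitesPerDir 0 = (F.P (J + (t + 1))).sitesPerDir (t + 1) := F.sitesPerDir_eq (by omega)
  have h01 : 0 + 1 ≤ (F.P (J + (t + 1))).m + (F.P (J + (t + 1))).K := by show 0 + 1 ≤ F.m + (J + (t + 1)); omega
  have htK : t + 1 ≤ (F.P (J + (t + 1))).m + (F.P (J + (t + 1))).K := by show t + 1 ≤ F.m + (J + (t + 1)); omega
  have hd : 0 < (F.P J).d := (F.P J).hd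
  have hLL : (F.P (J + (t + 1))).L = F.L := rfl
  -- the thickness-2 READ′ Pi-sups
  set R : PBond (F.P J) 0 → ℝ := fun B' => ‖(fun ℓ' : PBond (F.P (J + (t + 1))) 0 =>
        if ∃ z : Site (F.P (J + (t + 1))) 0,
                (B14.Eq22Determines.blockIter (t + 1) z = (bondShift (F.sitesPerDir_eq (m := F.m) (K := J) (j := 0) (m' := F.m) (K' := J + (t + 1)) (j' := t + 1) (by omega)) B').src ∨ B14.Eq22Determines.blockIter (t + 1) z = (bondShift (F.sitesPerDir_eq (m := F.m) (K := J) (j := 0) (m' := F.m) (K' := J + (t + 1)) (j' := t + 1) (by omega)) B').tgt) ∧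
                ∀ ν, (B10Eq27TorusAxialLog.rel z ℓ'.src ν).natAbs ≤ 2
        then g ℓ' else 0)‖ with hR
  have hR0 : ∀ B', 0 ≤ R B' := fun B' => norm_nonneg _
  let adj : PBond (F.P J) 0 → PBond (F.P J) 0 → Prop := fun B B' =>
    B'.dir = ⟨0, hd⟩ ∧ ((∀ ν, (rel B.src B'.src ν).natAbs ≤ k) ∨ (∀ ν, (rel B.tgt B'.src ν).natAbs ≤ k))
  -- STEP 1: per `B`
  have h1 : ∀ B : PBond (F.P J) 0, ‖(fun ℓ' : PBond (F.P (J + (t + 1))) 0 =>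
        if ∃ z : Site (F.P (J + (t + 1))) 0,
                (B14.Eq22Determines.blockIter (t + 1) z = (bondShift (F.sitesPerDir_eq (m := F.m) (K := J) (j := 0) (m' := F.m) (K' := J + (t + 1)) (j' := t + 1) (by omega)) B).src ∨ B14.Eq22Determines.blockIter (t + 1) z = (bondShift (F.sitesPerDir_eq (m := F.m) (K := J) (j := 0) (m' := F.m) (K' := J + (t + 1)) (j' := t + 1) (by omega)) B).tgt) ∧
                ∀ ν, (B10Eq27TorusAxialLog.rel z ℓ'.src ν).natAbs ≤ θr
        then g ℓ' else 0)‖ ^ 2 ≤ ∑ B' ∈ univ.filter (adj B), R B' ^ 2 := by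
    intro B
    set S : ℝ := ∑ B' ∈ univ.filter (adj B), R B' ^ 2 with hS
    have hS0 : 0 ≤ S := sum_nonneg fun B' _ => sq_nonneg _
    suffices hsup : ‖(fun ℓ' : PBond (F.P (J + (t + 1))) 0 =>
        if ∃ z : Site (F.P (J + (t + 1))) 0,
                (B14.Eq22Determines.blockIter (t + 1) z = (bondShift (F.sitesPerDir_eq (m := F.m) (K := J) (j := 0) (m' := F.m) (K' := J + (t + 1)) (j' := t + 1) (by omega)) B).src ∨ B14.Eq22Determines.blockIter (t + 1) z = (bondShift (F.sitesPerDir_eq (m := F.m) (K := J) (j := 0) (m' := F.m) (K' := J + (t + 1)) (j' := t + 1) (by omega)) B).tgt) ∧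
                ∀ ν, (B10Eq27TorusAxialLog.rel z ℓ'.src ν).natAbs ≤ θr
        then g ℓ' else 0)‖ ≤ Real.sqrt S by
      calc _ ≤ Real.sqrt S ^ 2 := pow_le_pow_left₀ (norm_nonneg _) hsup 2
        _ = S := Real.sq_sqrt hS0
    refine (pi_norm_le_iff_of_nonneg (Real.sqrt_nonneg S)).mpr fun ℓ' => ?_
    by_cases hb : ∃ z : Site (F.P (J + (t + 1))) 0,
                (B14.Eq22Determines.blockIter (t + 1) z = (bondShift (F.sitesPerDir_eq (m := F.m) (K := J) (j := 0) (m' := F.m) (K' := J + (t + 1)) (j' := t + 1) (by omega)) B).src ∨ B14.Eq22Determines.blockIter (t + 1) z = (bondShift (F.sitesPerDir_eq (m := F.m) (K := J) (j := 0) (m' := F.m) (K' := J + (t + 1)) (j' := t + 1) (by omega)) B).tgt) ∧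
                ∀ ν, (B10Eq27TorusAxialLog.rel z ℓ'.src ν).natAbs ≤ θr
    · rw [if_pos hb]
      obtain ⟨z, hzB, hzr⟩ := hb
      let y₀ : Site (F.P (J + (t + 1))) (t + 1) := B14.Eq22Determines.blockIter (t + 1) ℓ'.src
      let B₀ : PBond (F.P J) 0 := ⟨(siteShift P₁).symm y₀, ⟨0, hd⟩⟩
      have hsrc : (bondShift P₁ B₀).src = y₀ := by
        rw [bondShift_src]; exact (siteShift P₁).apply_symm_apply y₀
      have hread : ∃ z : Site (F.P (J + (t + 1))) 0,
                (B14.Eq22Determines.blockIter (t + 1) z = (bondShift (F.sitesPerDir_eq (m := F.m) (K := J) (j := 0) (m' := F.m) (K' := J + (t + 1)) (j' := t + 1) (by omega)) B₀).src ∨ B14.Eq22Determines.blockIter (t + 1) z = (bondShift (F.sitesPerDir_eq (m := F.m) (K := J) (j := 0) (m' := F.m) (K' := J + (t + 1)) (j' := t + 1) (by omega)) B₀).tgt) ∧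
                ∀ ν, (B10Eq27TorusAxialLog.rel z ℓ'.src ν).natAbs ≤ 2 :=
        ⟨ℓ'.src, Or.inl hsrc.symm, fun ν => by rw [rel_self]; simp⟩
      have hle : ‖g ℓ'‖ ≤ R B₀ := by
        have := norm_le_pi_norm (fun ℓ' : PBond (F.P (J + (t + 1))) 0 =>
          if ∃ z : Site (F.P (J + (t + 1))) 0,
                (B14.Eq22Determines.blockIter (t + 1) z = (bondShift (F.sitesPerDir_eq (m := F.m) (K := J) (j := 0) (m' := F.m) (K' := J + (t + 1)) (j' := t + 1) (by omega)) B₀).src ∨ B14.Eq22Determines.blockIter (t + 1) z = (bondShift (F.sitesPerDir_eq (m := F.m) (K := J) (j := 0) (m' := F.m) (K' := J + (t + 1)) (j' := t + 1) (by omega)) B₀).tgt) ∧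
                ∀ ν, (B10Eq27TorusAxialLog.rel z ℓ'.src ν).natAbs ≤ 2
          then g ℓ' else 0) ℓ'
        rwa [if_pos hread] at this
      -- `B₀` is within `k` of an endpoint of `B`: one blocking divides the thickness by `L`, the rest is non-expansive
      have hdist : ∀ ν, (rel (B14.Eq22Determines.blockIter (t + 1) z) y₀ ν).natAbs ≤ k := by
        intro ν
        refine natAbs_rel_blockIter_mono (show 1 ≤ t + 1 by omega) htK z ℓ'.src ν ?_
        show (rel (blockOf z) (blockOf ℓ'.src) ν).natAbs ≤ k
        exact natAbs_rel_blockOf_le_of_le_mul h01 z ℓ'.src ν k (by rw [hLL]; exact (hzr ν).trans hk)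
      have hadj : adj B B₀ := by
        refine ⟨rfl, ?_⟩
        rcases hzB with hz | hz
        · left
          intro ν
          have hzs : B14.Eq22Determines.blockIter (t + 1) z = siteShift P₁ B.src := hz
          have e := natAbs_rel_siteShift P₁ B.src ((siteShift P₁).symm y₀) ν
          rw [(siteShift P₁).apply_symm_apply, ← hzs] at e
          exact e.symm.le.trans (hdist ν)
        · right
          intro ν
          have hzt : B14.Eq22Determines.blockIter (t + 1) z = siteShift P₁ B.tgt := hz.trans (bondShift_tgt P₁ B)
          have e := natAbs_rel_siteShift P₁ B.tgt ((siteShift P₁).symm y₀) ν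
          rw [(siteShift P₁).apply_symm_apply, ← hzt] at e
          exact e.symm.le.trans (hdist ν)
      have hmem : B₀ ∈ univ.filter (adj B) := by rw [mem_filter]; exact ⟨mem_univ _, hadj⟩
      have hsq : R B₀ ^ 2 ≤ S := by
        rw [hS]
        exact single_le_sum (f := fun B' => R B' ^ 2) (fun B' _ => sq_nonneg (R B')) hmem
      calc ‖g ℓ'‖ ≤ R B₀ := hle
        _ ≤ Real.sqrt S := (Real.le_sqrt (hR0 B₀) hS0).mpr hsq
    · rw [if_neg hb, norm_zero]
      exact Real.sqrt_nonneg S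
  -- STEP 2: the double count
  have hcard : ∀ B' : PBond (F.P J) 0, ((univ.filter (fun B : PBond (F.P J) 0 => adj B B')).card : ℝ) ≤ ((2 * (F.P J).d * (2 * k + 1) ^ (F.P J).d : ℕ) : ℝ) := by
    intro B'
    have hsub : univ.filter (fun B : PBond (F.P J) 0 => adj B B') ⊆
        univ.filter (fun B : PBond (F.P J) 0 => (∀ ν, (rel B.src B'.src ν).natAbs ≤ k) ∨ (∀ ν, (rel B.tgt B'.src ν).natAbs ≤ k)) := by
      intro B hB
      rw [mem_filter] at hB ⊢
      exact ⟨hB.1, hB.2.2⟩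
    have h := (card_le_card hsub).trans (card_bonds_nearBox_le B'.src k)
    exact_mod_cast h
  calc ∑ B : PBond (F.P J) 0, ‖(fun ℓ' : PBond (F.P (J + (t + 1))) 0 =>
        if ∃ z : Site (F.P (J + (t + 1))) 0,
                (B14.Eq22Determines.blockIter (t + 1) z = (bondShift (F.sitesPerDir_eq (m := F.m) (K := J) (j := 0) (m' := F.m) (K' := J + (t + 1)) (j' := t + 1) (by omega)) B).src ∨ B14.Eq22Determines.blockIter (t + 1) z = (bondShift (F.sitesPerDir_eq (m := F.m) (K := J) (j := 0) (m' := F.m) (K' := J + (t + 1)) (j' := t + 1) (by omega)) B).tgt) ∧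
                ∀ ν, (B10Eq27TorusAxialLog.rel z ℓ'.src ν).natAbs ≤ θr
        then g ℓ' else 0)‖ ^ 2
      ≤ ∑ B : PBond (F.P J) 0, ∑ B' ∈ univ.filter (adj B), R B' ^ 2 := sum_le_sum fun B _ => h1 B
    _ = ∑ B : PBond (F.P J) 0, ∑ B' : PBond (F.P J) 0, (if adj B B' then R B' ^ 2 else 0) := by
        refine sum_congr rfl fun B _ => ?_
        rw [sum_filter]
    _ = ∑ B' : PBond (F.P J) 0, ∑ B : PBond (F.P J) 0, (if adj B B' then R B' ^ 2 else 0) := sum_comm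
    _ = ∑ B' : PBond (F.P J) 0, ((univ.filter (fun B : PBond (F.P J) 0 => adj B B')).card : ℝ) * R B' ^ 2 := by
        refine sum_congr rfl fun B' _ => ?_
        rw [← sum_filter, sum_const, nsmul_eq_mul]
    _ ≤ ∑ B' : PBond (F.P J) 0, ((2 * (F.P J).d * (2 * k + 1) ^ (F.P J).d : ℕ) : ℝ) * R B' ^ 2 :=
        sum_le_sum fun B' _ => mul_le_mul_of_nonneg_right (hcard B') (sq_nonneg _)
    _ = ((2 * (F.P J).d * (2 * k + 1) ^ (F.P J).d : ℕ) : ℝ) * ∑ B' : PBond (F.P J) 0, R B' ^ 2 := by rw [mul_sum]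

end Cover

end Summit.QuantumFields.YangMills.Theorems.FluctuationComparisonRegPrIntLS2BetaThickReadCover
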